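import Summits.Ventures.PackingBounds.Configurations.SimplexCrossPolytopeConfigs

/-!
# The diplo-simplex (`±` simplex, `2n + 2` points of `S^{n-1}`): its energy for every potential, every `n`

Framing: lottery ticket; floor = certified bounds/negative ranges. Venture `PackingBounds` (cell `pub-packcert`,
seat `pub-packcert-energy`, gen 25) — ATTAINED side only (no optimality claim).

`Configurations/SimplexCrossPolytopeConfigs` builds the `±` simplex `{± q_i}` (`q_0, …, q_n` a regular simplex of
`𝟙^⊥ ⊆ ℝⁿ⁺¹`) and moves it to `ℝⁿ` as a *code* (`exists_pm_simplex`: pairwise inner products `≤ 1/n`). This file adds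
its *energy*: every vertex sees its antipode once (inner product `-1`), the `n` other vertices of its own simplex
(`-1/n`) and the `n` non-antipodal vertices of the other simplex (`+1/n`), so for every potential `a`
`Σ_{x ≠ y} a(⟪x, y⟫) = (2n + 2) (a(-1) + n a(-1/n) + n a(1/n))` (`exists_config`), and for every function `g` of the
distance `Σ_{x ≠ y} g(‖x - y‖) = (2n + 2) (g 2 + n g(√(2 + 2/n)) + n g(√(2 - 2/n)))` (`exists_config_dist`).
The diplo-simplex (Conway–Sloane's name) is the conjectured harmonic-energy optimum for `2n + 2` points, `n ≥ 6`
(Ballinger–Blekherman–Cohn–Giansiracusa–Kelly–Schürmann 2009, §3.4; numerical); the cell's float three-point scan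
(E3PT §2v (xvi)) finds the degree-8 three-point bound sharp for the Riesz `s = 1` energy at `n = 8, 9, 10, 12`. The
exact energies below are the cell's pre-registered EXPECT constants (STRUCTURE.md §3, P-E5/P-E6) now in the kernel as
UPPER bounds for the ground-state energies: `(8, 18)`: `Σ 1/‖x-y‖ = 105 + (288/7)√7`, `Σ 1/‖x-y‖² = 2111/14`;
`(9, 20)`: `145 + 54√5`; `(10, 22)`: `11 + 20√55 + (220/3)√5`; `(12, 26)`: `13 + 24√78 + (312/11)√66` (ordered pairs).

## References
* B. Ballinger, G. Blekherman, H. Cohn, N. Giansiracusa, E. Kelly, A. Schürmann, *Experimental study of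
  energy-minimizing point configurations on spheres*, Experiment. Math. 18 (2009) 257–283, §3.4. [`BallingerEtAl2009`]
* J. H. Conway, N. J. A. Sloane, *Sphere Packings, Lattices and Groups*, 3rd ed., Ch. 1 §2.3, Ch. 4 §6.1 (`Aₙ*`,
  the diplo-simplex as its contact polytope). [`ConwaySloane1999`]
-/

noncomputable section

open Finset
open scoped RealInnerProductSpace

namespace Summit.Ventures.PackingBounds.Config.DiploSimplex

open Summit.Ventures.PackingBounds.Config.SimplexCrossPolytope

variable {n : ℕ}

/-- A vertex and its antipode: inner product `-1`. -/
theorem inner_pmVec_antipode (hn : 1 ≤ n) (i : Fin (n + 1)) {b c : Bool} (hbc : b ≠ c) :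
    inner ℝ (pmVec n (i, b)) (pmVec n (i, c)) = -1 := by
  rw [inner_pmVec hn, if_pos rfl, sgn_mul_of_ne hbc, mul_one]

/-- Two vertices of the same simplex: inner product `-1/n`. -/
theorem inner_pmVec_same (hn : 1 ≤ n) {i j : Fin (n + 1)} (hij : i ≠ j) (b : Bool) :
    inner ℝ (pmVec n (i, b)) (pmVec n (j, b)) = -1 / (n : ℝ) := by
  rw [inner_pmVec hn, if_neg hij, sgn_mul_self, one_mul]

/-- A vertex of one simplex and a non-antipodal vertex of the other: inner product `1/n`. -/
theorem inner_pmVec_other (hn : 1 ≤ n) {i j : Fin (n + 1)} (hij : i ≠ j) {b c : Bool} (hbc : b ≠ c) :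
    inner ℝ (pmVec n (i, b)) (pmVec n (j, c)) = 1 / (n : ℝ) := by
  rw [inner_pmVec hn, if_neg hij, sgn_mul_of_ne hbc]
  ring

/-- The pairwise inner products of distinct vertices are `-1`, `-1/n` or `1/n`. -/
theorem inner_pmVec_mem (hn : 1 ≤ n) {p q : Fin (n + 1) × Bool} (hpq : p ≠ q) :
    inner ℝ (pmVec n p) (pmVec n q) = -1 ∨ inner ℝ (pmVec n p) (pmVec n q) = -1 / (n : ℝ) ∨
      inner ℝ (pmVec n p) (pmVec n q) = 1 / (n : ℝ) := by
  obtain ⟨i, b⟩ := p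
  obtain ⟨j, c⟩ := q
  by_cases hij : i = j
  · subst hij
    have hbc : b ≠ c := fun h => hpq (by rw [h])
    exact Or.inl (inner_pmVec_antipode hn i hbc)
  · by_cases hbc : b = c
    · subst hbc
      exact Or.inr (Or.inl (inner_pmVec_same hn hij b))
    · exact Or.inr (Or.inr (inner_pmVec_other hn hij hbc))

/-- `|± simplex| = 2n + 2` (`n ≥ 2`); the `±` simplex is the finset `univ.image (pmVec n)` of `ℝⁿ⁺¹` (inside `𝟙^⊥`). -/
theorem card_pmSimplex (hn : 2 ≤ n) :
    ((univ : Finset (Fin (n + 1) × Bool)).image (pmVec n)).card = 2 * n + 2 := by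
  classical
  rw [card_image_of_injective _ (pmVec_injective hn), card_univ, Fintype.card_prod, Fintype.card_fin,
    Fintype.card_bool]
  ring

/-- One row of the energy sum: a vertex `± q_{i₀}` sees `-1` once, `-1/n` `n` times and `1/n` `n` times. -/
theorem row_energy (hn : 2 ≤ n) (a : ℝ → ℝ) (p : Fin (n + 1) × Bool) :
    ∑ y ∈ ((univ : Finset (Fin (n + 1) × Bool)).image (pmVec n)).erase (pmVec n p), a (inner ℝ (pmVec n p) y) =
      a (-1) + n * a (-1 / (n : ℝ)) + n * a (1 / (n : ℝ)) := by
  classical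
  have hn1 : 1 ≤ n := le_trans (by norm_num) hn
  have hinj := pmVec_injective hn
  obtain ⟨i0, b0⟩ := p
  rw [← image_erase hinj, sum_image fun x _ y _ h => hinj h, sum_erase_eq_sub (mem_univ _),
    inner_pmVec hn1 (i0, b0) (i0, b0), if_pos rfl, sgn_mul_self, one_mul, Fintype.sum_prod_type]
  have hterm : ∀ i : Fin (n + 1), ∑ b : Bool, a (inner ℝ (pmVec n (i0, b0)) (pmVec n (i, b))) =
      (a (-1 / (n : ℝ)) + a (1 / (n : ℝ))) +
        if i0 = i then a 1 + a (-1) - a (-1 / (n : ℝ)) - a (1 / (n : ℝ)) else 0 := by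
    intro i
    rw [Fintype.sum_bool]
    by_cases hi : i0 = i
    · subst hi
      rw [if_pos rfl]
      cases b0
      · rw [inner_pmVec_antipode hn1 i0 (by decide), inner_pmVec hn1, if_pos rfl, sgn_mul_self, one_mul]
        ring
      · rw [inner_pmVec hn1 (i0, true) (i0, true), if_pos rfl, sgn_mul_self, one_mul,
          inner_pmVec_antipode hn1 i0 (by decide)]
        ring
    · rw [if_neg hi]
      cases b0
      · rw [inner_pmVec_other hn1 hi (by decide), inner_pmVec_same hn1 hi]
        ring
      · rw [inner_pmVec_same hn1 hi, inner_pmVec_other hn1 hi (by decide)]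
        ring
  rw [Finset.sum_congr rfl fun i _ => hterm i, sum_add_distrib, sum_const, card_univ, Fintype.card_fin,
    sum_ite_eq, if_pos (mem_univ _), nsmul_eq_mul]
  push_cast
  ring

/-- **Energy of the `±` simplex** (in `𝟙^⊥ ⊆ ℝⁿ⁺¹`): for every potential `a`,
`Σ_{x ≠ y} a(⟪x, y⟫) = (2n + 2) (a(-1) + n a(-1/n) + n a(1/n))`. -/
theorem pmSimplex_energy (hn : 2 ≤ n) (a : ℝ → ℝ) :
    ∑ x ∈ (univ : Finset (Fin (n + 1) × Bool)).image (pmVec n),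
      ∑ y ∈ ((univ : Finset (Fin (n + 1) × Bool)).image (pmVec n)).erase x, a (inner ℝ x y) =
      (2 * n + 2 : ℝ) * (a (-1) + n * a (-1 / (n : ℝ)) + n * a (1 / (n : ℝ))) := by
  classical
  have hinj := pmVec_injective hn
  rw [sum_image fun x _ y _ h => hinj h]
  simp_rw [row_energy hn a]
  rw [sum_const, card_univ, Fintype.card_prod, Fintype.card_fin, Fintype.card_bool, nsmul_eq_mul]
  push_cast
  ring

/-- **The diplo-simplex configuration in `ℝⁿ` (every `n ≥ 2`)**: `2n + 2` unit vectors of `ℝⁿ` with pairwise inner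
products in `{-1, -1/n, 1/n}` and, for every potential `a`, energy `(2n + 2) (a(-1) + n a(-1/n) + n a(1/n))`
(ordered pairs). [cite: BallingerEtAl2009, §3.4] -/
theorem exists_config (n : ℕ) (hn : 2 ≤ n) : ∃ C : Finset (EuclideanSpace ℝ (Fin n)), C.card = 2 * n + 2 ∧
    (∀ x ∈ C, ‖x‖ = 1) ∧
    (∀ x ∈ C, ∀ y ∈ C, x ≠ y →
      inner ℝ x y = -1 ∨ inner ℝ x y = -1 / (n : ℝ) ∨ inner ℝ x y = 1 / (n : ℝ)) ∧
    ∀ a : ℝ → ℝ, ∑ x ∈ C, ∑ y ∈ C.erase x, a (inner ℝ x y) =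
      (2 * n + 2 : ℝ) * (a (-1) + n * a (-1 / (n : ℝ)) + n * a (1 / (n : ℝ))) := by
  classical
  have hn1 : 1 ≤ n := le_trans (by norm_num) hn
  obtain ⟨C', hcard, hnorm, hinner, henergy⟩ := exists_transfer_orthogonal_singleton (ones n) (ones_ne_zero n)
    ((univ : Finset (Fin (n + 1) × Bool)).image (pmVec n))
    (fun x hx => by obtain ⟨p, _, rfl⟩ := mem_image.mp hx; exact inner_ones_pmVec n p)
  refine ⟨C', by rw [hcard, card_pmSimplex hn], ?_, ?_, fun a => by rw [henergy a, pmSimplex_energy hn a]⟩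
  · intro x hx
    obtain ⟨y, hy, h⟩ := hnorm x hx
    obtain ⟨p, _, rfl⟩ := mem_image.mp hy
    rw [h, norm_pmVec hn1]
  · intro x hx y hy hxy
    obtain ⟨x0, hx0, y0, hy0, hne, he⟩ := hinner x hx y hy hxy
    obtain ⟨p, _, rfl⟩ := mem_image.mp hx0
    obtain ⟨q, _, rfl⟩ := mem_image.mp hy0
    rw [he]
    exact inner_pmVec_mem hn1 fun h => hne (by rw [h])

/-- For unit vectors `‖x - y‖ = √(2 - 2⟪x, y⟫)`. -/
theorem norm_sub_eq_sqrt {m : ℕ} {x y : EuclideanSpace ℝ (Fin m)} (hx : ‖x‖ = 1) (hy : ‖y‖ = 1) :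
    ‖x - y‖ = Real.sqrt (2 - 2 * inner ℝ x y) := by
  have hsq : ‖x - y‖ ^ 2 = 2 - 2 * inner ℝ x y := by
    rw [norm_sub_sq_real, hx, hy]; ring
  rw [← hsq, Real.sqrt_sq (norm_nonneg _)]

/-- **The diplo-simplex, distance form (every `n ≥ 2`)**: `2n + 2` unit vectors of `ℝⁿ` whose pairwise distances
are `2` (antipode, once per point), `√(2 + 2/n)` (own simplex, `n` per point) and `√(2 - 2/n)` (other simplex, `n` per
point): for every `g`, `Σ_{x ≠ y} g(‖x - y‖) = (2n + 2) (g 2 + n g(√(2 + 2/n)) + n g(√(2 - 2/n)))`.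
[cite: BallingerEtAl2009, §3.4] -/
theorem exists_config_dist (n : ℕ) (hn : 2 ≤ n) : ∃ C : Finset (EuclideanSpace ℝ (Fin n)), C.card = 2 * n + 2 ∧
    (∀ x ∈ C, ‖x‖ = 1) ∧
    ∀ g : ℝ → ℝ, ∑ x ∈ C, ∑ y ∈ C.erase x, g ‖x - y‖ =
      (2 * n + 2 : ℝ) * (g 2 + n * g (Real.sqrt (2 + 2 / (n : ℝ))) + n * g (Real.sqrt (2 - 2 / (n : ℝ)))) := by
  obtain ⟨C, hc, h1, -, he⟩ := exists_config n hn
  refine ⟨C, hc, h1, fun g => ?_⟩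
  have key := he (fun t => g (Real.sqrt (2 - 2 * t)))
  beta_reduce at key
  have h4 : Real.sqrt (2 - 2 * (-1 : ℝ)) = 2 := by
    rw [show (2 : ℝ) - 2 * (-1) = 2 ^ 2 by norm_num, Real.sqrt_sq (by norm_num)]
  have hm : (2 : ℝ) - 2 * (-1 / (n : ℝ)) = 2 + 2 / (n : ℝ) := by ring
  have hp : (2 : ℝ) - 2 * (1 / (n : ℝ)) = 2 - 2 / (n : ℝ) := by ring
  rw [h4, hm, hp] at key
  rw [← key]
  exact sum_congr rfl fun x hx => sum_congr rfl fun y hy => by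
    rw [norm_sub_eq_sqrt (h1 x hx) (h1 y (mem_of_mem_erase hy))]

/-! ## The pre-registered exact energies (cell STRUCTURE.md §3, P-E5 / P-E6) -/

/-- `√(2 - 2/8) = √7 / 2`. -/
private theorem sqrt_dist8 : Real.sqrt (2 - 2 / (8 : ℝ)) = Real.sqrt 7 / 2 := by
  rw [show (2 : ℝ) - 2 / 8 = 7 / 2 ^ 2 by norm_num, Real.sqrt_div' _ (by norm_num), Real.sqrt_sq (by norm_num)]

/-- `√(2 + 2/8) = 3 / 2`. -/
private theorem sqrt_simp8 : Real.sqrt (2 + 2 / (8 : ℝ)) = 3 / 2 := by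
  rw [show (2 : ℝ) + 2 / 8 = (3 / 2) ^ 2 by norm_num, Real.sqrt_sq (by norm_num)]

/-- **`(8, 18)`, Riesz `s = 1` (P-E5):** the diplo-simplex of `ℝ⁸` has `Σ_{x ≠ y} 1/‖x - y‖ = 105 + (288/7)√7`
(`= 213.8537682…`, ordered pairs); hence the least Riesz-1 energy of `18` points of `S⁷` is at most this.
[cite: BallingerEtAl2009, §3.4] -/
theorem diplo8_riesz_one : ∃ C : Finset (EuclideanSpace ℝ (Fin 8)), C.card = 18 ∧ (∀ x ∈ C, ‖x‖ = 1) ∧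
    ∑ x ∈ C, ∑ y ∈ C.erase x, 1 / ‖x - y‖ = 105 + 288 / 7 * Real.sqrt 7 := by
  obtain ⟨C, hc, h1, he⟩ := exists_config_dist 8 (by norm_num)
  refine ⟨C, hc, h1, ?_⟩
  rw [he (fun r => 1 / r)]
  simp only [Nat.cast_ofNat]
  rw [sqrt_dist8, sqrt_simp8]
  have h7 : Real.sqrt 7 * Real.sqrt 7 = 7 := Real.mul_self_sqrt (by norm_num)
  have h7' : Real.sqrt 7 ≠ 0 := by positivity
  field_simp
  nlinarith [h7]

/-- **`(8, 18)`, Riesz `s = 2` (P-E6):** the diplo-simplex of `ℝ⁸` has `Σ_{x ≠ y} 1/‖x - y‖² = 2111/14`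
(ordered pairs). [cite: BallingerEtAl2009, §3.4] -/
theorem diplo8_riesz_two : ∃ C : Finset (EuclideanSpace ℝ (Fin 8)), C.card = 18 ∧ (∀ x ∈ C, ‖x‖ = 1) ∧
    ∑ x ∈ C, ∑ y ∈ C.erase x, 1 / ‖x - y‖ ^ 2 = 2111 / 14 := by
  obtain ⟨C, hc, h1, he⟩ := exists_config_dist 8 (by norm_num)
  refine ⟨C, hc, h1, ?_⟩
  rw [he (fun r => 1 / r ^ 2)]
  simp only [Nat.cast_ofNat]
  rw [sqrt_dist8, sqrt_simp8]
  have h7 : Real.sqrt 7 ^ 2 = 7 := Real.sq_sqrt (by norm_num)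
  simp only [div_pow, h7]
  norm_num

/-- **`(9, 20)`, Riesz `s = 1` (P-E6):** the diplo-simplex of `ℝ⁹` has `Σ_{x ≠ y} 1/‖x - y‖ = 145 + 54√5`
(`= 265.7476707…`). [cite: BallingerEtAl2009, §3.4] -/
theorem diplo9_riesz_one : ∃ C : Finset (EuclideanSpace ℝ (Fin 9)), C.card = 20 ∧ (∀ x ∈ C, ‖x‖ = 1) ∧
    ∑ x ∈ C, ∑ y ∈ C.erase x, 1 / ‖x - y‖ = 145 + 54 * Real.sqrt 5 := by
  obtain ⟨C, hc, h1, he⟩ := exists_config_dist 9 (by norm_num)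
  refine ⟨C, hc, h1, ?_⟩
  have hs : Real.sqrt (2 - 2 / (9 : ℝ)) = 4 / 3 := by
    rw [show (2 : ℝ) - 2 / 9 = (4 / 3) ^ 2 by norm_num, Real.sqrt_sq (by norm_num)]
  have hp : Real.sqrt (2 + 2 / (9 : ℝ)) = 2 * Real.sqrt 5 / 3 := by
    rw [show (2 : ℝ) + 2 / 9 = 2 ^ 2 * 5 / 3 ^ 2 by norm_num, Real.sqrt_div' _ (by norm_num),
      Real.sqrt_mul' _ (by norm_num), Real.sqrt_sq (by norm_num), Real.sqrt_sq (by norm_num)]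
  rw [he (fun r => 1 / r)]
  simp only [Nat.cast_ofNat]
  rw [hs, hp]
  have h5 : Real.sqrt 5 * Real.sqrt 5 = 5 := Real.mul_self_sqrt (by norm_num)
  have h5' : Real.sqrt 5 ≠ 0 := by positivity
  field_simp
  nlinarith [h5]

/-- **`(10, 22)`, Riesz `s = 1` (P-E6):** the diplo-simplex of `ℝ¹⁰` has
`Σ_{x ≠ y} 1/‖x - y‖ = 11 + 20√55 + (220/3)√5` (`= 323.3022880…`). [cite: BallingerEtAl2009, §3.4] -/
theorem diplo10_riesz_one : ∃ C : Finset (EuclideanSpace ℝ (Fin 10)), C.card = 22 ∧ (∀ x ∈ C, ‖x‖ = 1) ∧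
    ∑ x ∈ C, ∑ y ∈ C.erase x, 1 / ‖x - y‖ = 11 + 20 * Real.sqrt 55 + 220 / 3 * Real.sqrt 5 := by
  obtain ⟨C, hc, h1, he⟩ := exists_config_dist 10 (by norm_num)
  refine ⟨C, hc, h1, ?_⟩
  have hs : Real.sqrt (2 - 2 / (10 : ℝ)) = 3 * Real.sqrt 5 / 5 := by
    rw [show (2 : ℝ) - 2 / 10 = 3 ^ 2 * 5 / 5 ^ 2 by norm_num, Real.sqrt_div' _ (by norm_num),
      Real.sqrt_mul' _ (by norm_num), Real.sqrt_sq (by norm_num), Real.sqrt_sq (by norm_num)]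
  have hp : Real.sqrt (2 + 2 / (10 : ℝ)) = Real.sqrt 55 / 5 := by
    rw [show (2 : ℝ) + 2 / 10 = 55 / 5 ^ 2 by norm_num, Real.sqrt_div' _ (by norm_num), Real.sqrt_sq (by norm_num)]
  rw [he (fun r => 1 / r)]
  simp only [Nat.cast_ofNat]
  rw [hs, hp]
  have h5 : Real.sqrt 5 * Real.sqrt 5 = 5 := Real.mul_self_sqrt (by norm_num)
  have h55 : Real.sqrt 55 * Real.sqrt 55 = 55 := Real.mul_self_sqrt (by norm_num)
  have h5' : Real.sqrt 5 ≠ 0 := by positivity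
  have h55' : Real.sqrt 55 ≠ 0 := by positivity
  have i1 : 1 / (3 * Real.sqrt 5 / 5) = Real.sqrt 5 / 3 := by
    field_simp
    nlinarith [h5]
  have i2 : 1 / (Real.sqrt 55 / 5) = Real.sqrt 55 / 11 := by
    field_simp
    nlinarith [h55]
  rw [i1, i2]
  ring

/-- **`(12, 26)`, Riesz `s = 1` (P-E6):** the diplo-simplex of `ℝ¹²` has
`Σ_{x ≠ y} 1/‖x - y‖ = 13 + 24√78 + (312/11)√66` (`= 455.3895319…`). [cite: BallingerEtAl2009, §3.4] -/
theorem diplo12_riesz_one : ∃ C : Finset (EuclideanSpace ℝ (Fin 12)), C.card = 26 ∧ (∀ x ∈ C, ‖x‖ = 1) ∧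
    ∑ x ∈ C, ∑ y ∈ C.erase x, 1 / ‖x - y‖ = 13 + 24 * Real.sqrt 78 + 312 / 11 * Real.sqrt 66 := by
  obtain ⟨C, hc, h1, he⟩ := exists_config_dist 12 (by norm_num)
  refine ⟨C, hc, h1, ?_⟩
  have hs : Real.sqrt (2 - 2 / (12 : ℝ)) = Real.sqrt 66 / 6 := by
    rw [show (2 : ℝ) - 2 / 12 = 66 / 6 ^ 2 by norm_num, Real.sqrt_div' _ (by norm_num), Real.sqrt_sq (by norm_num)]
  have hp : Real.sqrt (2 + 2 / (12 : ℝ)) = Real.sqrt 78 / 6 := by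
    rw [show (2 : ℝ) + 2 / 12 = 78 / 6 ^ 2 by norm_num, Real.sqrt_div' _ (by norm_num), Real.sqrt_sq (by norm_num)]
  rw [he (fun r => 1 / r)]
  simp only [Nat.cast_ofNat]
  rw [hs, hp]
  have h66 : Real.sqrt 66 * Real.sqrt 66 = 66 := Real.mul_self_sqrt (by norm_num)
  have h78 : Real.sqrt 78 * Real.sqrt 78 = 78 := Real.mul_self_sqrt (by norm_num)
  have h66' : Real.sqrt 66 ≠ 0 := by positivity
  have h78' : Real.sqrt 78 ≠ 0 := by positivity
  have i1 : 1 / (Real.sqrt 66 / 6) = Real.sqrt 66 / 11 := by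
    field_simp
    nlinarith [h66]
  have i2 : 1 / (Real.sqrt 78 / 6) = Real.sqrt 78 / 13 := by
    field_simp
    nlinarith [h78]
  rw [i1, i2]
  ring

end Summit.Ventures.PackingBounds.Config.DiploSimplex
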